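import Summits.Ventures.CertifiedManyBodySolver.HubbardAlg.GSWindowNodeD4
import Literature.MathematicalPhysics.QuantumLattice.InfVolFermionStateTorusLimitLocalStability
import Literature.MathematicalPhysics.QuantumLattice.HubbardTorusLocalHamiltonianDecomposition
import Literature.MathematicalPhysics.QuantumLattice.HubbardFermionInteractionLocalHamiltonian
import Literature.MathematicalPhysics.QuantumLattice.HubbardJordanWignerLocality
import HarnessLib

/-!
# GSTermwiseRows — term-wise relocated ground-state rows for the `GSObsNode` interface (hubbard-alg L2, R2-TW)

HONEST FRAMING: ladder R1–R4 with certified numbers; no claim on H/H₀; bounds for model classes, no materials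
claim.  (hubbard-alg: first certified bounds; not a superconductivity verdict; every number certified or labelled
float — this file has NO number: it is row SOUNDNESS only.)

`GSObsNode t U n W O lo` (#232): every translation-invariant even torus-limit ground state `ω` of the class obeys
`lo ≤ Re ω_W(O)`.  `stabilityObs' t U B A = Ã⋆[H_{B⁺}, Ã]` (`B⁺ = thicken B 1`) needs all of `B⁺` in the window;
l2-idea-1's toy (`runs/idea1-toyV1-eom2x3/`) splits `[H_{B⁺}, Ã] = Σ_X [Φ X, Ã]` over the local terms (`X ⊆ B⁺`;
`Φ X = 0` off sites/bonds) and relocates each piece, supported on `B ∪ X`, by ITS OWN translation `g X` — sound in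
expectation since `ω ∘ τ_v = ω`.  §1 node algebra; §2 `relocate`, `expect_relocate`; §3 pieces `twCommPiece = [Φ X, X̃w]`,
`twPiece = Ã⋆[Φ X, Ã]`, graded locality, `sum_fermionEmbed_twCommPiece/_twPiece`; §4 `twCommObs`, `twStabilityObs`
(placement `g : Finset (Site 2) → Site 2`), `expect_twCommObs/_twStabilityObs`, the E2-type row `gsObsNode_twStability`
(`Commute A N`, `Commute A S^z`, placement ⇒ `GSObsNode … (twStabilityObs …) 0`, by `IsTorusLimitOf.localStability`);
§5 the two-sided E1-type row `gsObsNode_twStationarity` for EVERY word (`ω([H, X̃w]) = 0`, `stationarity_of_isTorusLimitOf`),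
`gsObsNode_smul_twCommObs`, and `gsObsNode_twRows`: `Σ_i y_i·twStabilityObs_i + Σ_k z_k·twCommObs_k` (`y ≥ 0`, `z : ℂ`)
is ONE `GSObsNode … 0` = the window leg of `energyDensity2D_ge_of_split`.  E2 BLOCKS via single words (`G = Σ λ_k w_k w_k⋆`
⇒ `tr(GK) = Σ λ_k ω(Ã_k⋆[H, Ã_k])`).  NOT covered: words not commuting with the local `N`, `S^z`; rotations/reflections.
Reader's recipe / l2 convention match: pub-hubbard `lean/README.md` § #237, `pub-hubbard-bounds/r2tw/CONSUMER-GUIDE.md`.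
References: [cite: BratteliRobinsonII1997, §5.2.2 + Prop. 5.3.25 + Thm. 6.2.4 + §6.2.2]; [cite: ArakiMoriya2003, §4.1 + §5.1];
[cite: EvansKawahigashi1998, §6.5]; [cite: KullEtAl2024, §II.B]; [cite: Ruelle1969, §3.4].
-/

noncomputable section

namespace Summit.Ventures.CertifiedManyBodySolver.HubbardAlg.GSTermwiseRows

open Matrix Finset _root_.Filter
open Literature.Probability.LatticeModels
open Literature.MathematicalPhysics.QuantumLattice
open Literature.MathematicalPhysics.QuantumLattice.HubbardWave0
open Literature.MathematicalPhysics.QuantumLattice.ThermodynamicLimit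
open Summit.Ventures.CertifiedManyBodySolver.HubbardAlg.GSWindowNodeD4
open scoped _root_.Topology ComplexOrder
/-! ## §1 Node algebra (`GSObsNode` is closed under non-negative scaling and finite sums) -/
/-- The zero observable is a node with floor `0`. -/
theorem gsObsNode_zero (t U n : ℝ) (W : Finset (Site 2)) : GSObsNode t U n W 0 0 := by
  intro ω ψ Ls _ _ _ _ _ _ _ _
  rw [map_zero, Complex.zero_re]
/-- Scaling a node by `c ≥ 0` scales its floor. -/
theorem gsObsNode_smul {t U n : ℝ} {W : Finset (Site 2)} {O : FermionOp W} {lo : ℝ}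
    (h : GSObsNode t U n W O lo) {c : ℝ} (hc : 0 ≤ c) : GSObsNode t U n W ((c : ℂ) • O) (c * lo) := by
  intro ω ψ Ls a b c' d e f g i
  have k := h ω ψ Ls a b c' d e f g i
  rw [map_smul, smul_eq_mul, Complex.re_ofReal_mul]
  exact mul_le_mul_of_nonneg_left k hc
/-- Scaling a floor-`0` node by `c ≥ 0` gives a floor-`0` node (the form used by dual certificates: `y_j ≥ 0`). -/
theorem gsObsNode_smul_nonneg {t U n : ℝ} {W : Finset (Site 2)} {O : FermionOp W}
    (h : GSObsNode t U n W O 0) {c : ℝ} (hc : 0 ≤ c) : GSObsNode t U n W ((c : ℂ) • O) 0 := by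
  simpa only [mul_zero] using gsObsNode_smul h hc
/-- Finite sums of nodes are nodes (floors add). -/
theorem gsObsNode_sum {t U n : ℝ} {W : Finset (Site 2)} {ι : Type*} (s : Finset ι)
    {O : ι → FermionOp W} {lo : ι → ℝ} (h : ∀ i ∈ s, GSObsNode t U n W (O i) (lo i)) :
    GSObsNode t U n W (∑ i ∈ s, O i) (∑ i ∈ s, lo i) := by
  classical
  induction s using Finset.induction_on with
  | empty => simpa only [Finset.sum_empty] using gsObsNode_zero t U n W
  | insert i s hi ih =>
    rw [Finset.sum_insert hi, Finset.sum_insert hi]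
    exact (h i (Finset.mem_insert_self i s)).add (ih fun j hj => h j (Finset.mem_insert_of_mem hj))
/-- Finite sums of floor-`0` nodes are floor-`0` nodes. -/
theorem gsObsNode_sum_nonneg {t U n : ℝ} {W : Finset (Site 2)} {ι : Type*} (s : Finset ι)
    {O : ι → FermionOp W} (h : ∀ i ∈ s, GSObsNode t U n W (O i) 0) :
    GSObsNode t U n W (∑ i ∈ s, O i) 0 := by
  simpa only [Finset.sum_const_zero] using gsObsNode_sum s h

/-! ## §2 Relocation of a local piece by a lattice translation -/
/-- **Relocation**: the translate `Γ(τ_v) P` of `P ∈ 𝔄_S`, embedded in `𝔄_W` when `S + v ⊆ W` (`0` otherwise: total). -/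
def relocate (W S : Finset (Site 2)) (v : Site 2) (P : FermionOp S) : FermionOp W :=
  if h : shiftSet v S ⊆ W then fermionEmbed (PolySite.incl h) (fermionEmbed (PolySite.shiftEmb v S) P) else 0
/-- `relocate` under a valid placement. -/
theorem relocate_of_subset {W S : Finset (Site 2)} {v : Site 2} (h : shiftSet v S ⊆ W) (P : FermionOp S) :
    relocate W S v P = fermionEmbed (PolySite.incl h) (fermionEmbed (PolySite.shiftEmb v S) P) := by
  rw [relocate, dif_pos h]
/-- `relocate` of the zero piece is zero (wherever it is placed). -/
theorem relocate_zero (W S : Finset (Site 2)) (v : Site 2) : relocate W S v (0 : FermionOp S) = 0 := by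
  unfold relocate
  split_ifs
  · rw [map_zero, map_zero]
  · rfl
/-- **Relocation is invisible to a translation-invariant state**: `ω_W(relocate W S v P) = ω_S(P)` (`S + v ⊆ W`). -/
theorem expect_relocate {ω : InfVolFermionState 2} (hω : ω.IsTranslationInvariant) {W S : Finset (Site 2)}
    {v : Site 2} (h : shiftSet v S ⊆ W) (P : FermionOp S) :
    ω.expect W (relocate W S v P) = ω.expect S P := by
  rw [relocate_of_subset h, ω.compatible h, ← InfVolFermionState.shift_expect, hω v]

/-! ## §3 The term pieces and their sum -/
section Pieces
variable (t U : ℝ)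
/-- **Commutator piece of one term**: `[Φ X, X̃w] ∈ 𝔄_{B ∪ X}` (`Φ = hubbardFermionInteraction 2 t U`; `0` off sites/bonds). -/
def twCommPiece (B X : Finset (Site 2)) (Xw : FermionOp B) : FermionOp (B ∪ X) :=
  fermionEmbed (PolySite.incl Finset.subset_union_right) ((hubbardFermionInteraction 2 t U).Φ X) *
      fermionEmbed (PolySite.incl Finset.subset_union_left) Xw -
    fermionEmbed (PolySite.incl Finset.subset_union_left) Xw *
      fermionEmbed (PolySite.incl Finset.subset_union_right) ((hubbardFermionInteraction 2 t U).Φ X)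

/-- **Stability piece of one interaction term**: `Ã⋆ [Φ X, Ã] ∈ 𝔄_{B ∪ X}`. -/
def twPiece (B X : Finset (Site 2)) (A : FermionOp B) : FermionOp (B ∪ X) :=
  (fermionEmbed (PolySite.incl Finset.subset_union_left) A)ᴴ * twCommPiece t U B X A

/-- Terms off the support of the interaction contribute nothing. -/
theorem twCommPiece_eq_zero {B X : Finset (Site 2)} (hX : (hubbardFermionInteraction 2 t U).Φ X = 0)
    (Xw : FermionOp B) : twCommPiece t U B X Xw = 0 := by
  rw [twCommPiece, hX, map_zero, zero_mul, mul_zero, sub_zero]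

/-- Terms off the support of the interaction contribute nothing. -/
theorem twPiece_eq_zero {B X : Finset (Site 2)} (hX : (hubbardFermionInteraction 2 t U).Φ X = 0)
    (A : FermionOp B) : twPiece t U B X A = 0 := by
  rw [twPiece, twCommPiece_eq_zero t U hX, mul_zero]

/-- The sites of `X` and of `B`, both embedded in `B ∪ X`, are disjoint when `X` and `B` are. -/
theorem disjoint_map_incl {B X : Finset (Site 2)} (h : Disjoint X B) :
    Disjoint
      ((Finset.univ : Finset (PolySite X)).map
        (PolySite.incl (Finset.subset_union_right (s₁ := B) (s₂ := X))))
      ((Finset.univ : Finset (PolySite B)).map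
        (PolySite.incl (Finset.subset_union_left (s₁ := B) (s₂ := X)))) := by
  refine Finset.disjoint_left.2 fun p hpX hpB => ?_
  obtain ⟨y, -, rfl⟩ := Finset.mem_map.1 hpX
  obtain ⟨y', -, hy'⟩ := Finset.mem_map.1 hpB
  have h1 : ofLex y.1 ∈ X := PolySite.ofLex_mem y
  have h2 : ofLex y'.1 ∈ B := PolySite.ofLex_mem y'
  have h3 : y'.1 = y.1 := by
    rw [← PolySite.coe_incl Finset.subset_union_left y', hy', PolySite.coe_incl]
  rw [h3] at h2
  exact Finset.disjoint_left.1 h h1 h2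

/-- **Graded locality**: a term not touching `B` commutes with every word on `B` (`hubbardFermionInteraction_isEven`,
`commute_fermionEmbed_of_mem_carEvenSubalgebra`), so its piece vanishes. [cite: BratteliRobinsonII1997, §5.2.2] -/
theorem twCommPiece_eq_zero_of_disjoint {B X : Finset (Site 2)} (h : Disjoint X B) (Xw : FermionOp B) :
    twCommPiece t U B X Xw = 0 := by
  have hc : Commute
      (fermionEmbed (PolySite.incl Finset.subset_union_right) ((hubbardFermionInteraction 2 t U).Φ X))
      (fermionEmbed (PolySite.incl (Finset.subset_union_left (s₁ := B) (s₂ := X))) Xw) :=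
    commute_fermionEmbed_of_mem_carEvenSubalgebra _ Xw
      (fermionEmbed_mem_carEvenSubalgebra _
        (JordanWigner.mem_carEvenSubalgebra_univ_of_parityAut_eq (hubbardFermionInteraction_isEven (d := 2) t U X)))
      (disjoint_orbs (disjoint_map_incl h))
  rw [twCommPiece, hc.eq, sub_self]

/-- The stability piece of a term not touching `B` vanishes. -/
theorem twPiece_eq_zero_of_disjoint {B X : Finset (Site 2)} (h : Disjoint X B) (A : FermionOp B) :
    twPiece t U B X A = 0 := by
  rw [twPiece, twCommPiece_eq_zero_of_disjoint t U h, mul_zero]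

/-- **The commutator pieces sum to `[H_{B⁺}, X̃w]`** in `𝔄_{B⁺}` (`localHamiltonian_eq_sum`). [cite: ArakiMoriya2003, §5.1] -/
theorem sum_fermionEmbed_twCommPiece (B : Finset (Site 2)) (Xw : FermionOp B) :
    ∑ X ∈ (thicken B 1).powerset,
        (if hX : X ⊆ thicken B 1 then
          fermionEmbed (PolySite.incl (Finset.union_subset (subset_thicken B 1) hX)) (twCommPiece t U B X Xw)
        else 0) =
      (hubbardFermionInteraction 2 t U).localHamiltonian (thicken B 1) *
          fermionEmbed (PolySite.incl (subset_thicken B 1)) Xw -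
        fermionEmbed (PolySite.incl (subset_thicken B 1)) Xw *
          (hubbardFermionInteraction 2 t U).localHamiltonian (thicken B 1) := by
  rw [FermionInteraction.localHamiltonian_eq_sum, Finset.sum_mul, Finset.mul_sum, ← Finset.sum_sub_distrib]
  refine Finset.sum_congr rfl fun X hX => ?_
  have hX' : X ⊆ thicken B 1 := Finset.mem_powerset.1 hX
  rw [dif_pos hX', dif_pos hX', twCommPiece, fermionEmbed_sub, fermionEmbed_mul, fermionEmbed_mul]
  simp only [fermionEmbed_fermionEmbed, PolySite.incl_trans]

/-- **The stability pieces sum to `stabilityObs' t U B A = Ã⋆[H_{B⁺}, Ã]`** in `𝔄_{B⁺}`. [cite: BratteliRobinsonII1997, Prop. 5.3.25] -/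
theorem sum_fermionEmbed_twPiece (B : Finset (Site 2)) (A : FermionOp B) :
    ∑ X ∈ (thicken B 1).powerset,
        (if hX : X ⊆ thicken B 1 then
          fermionEmbed (PolySite.incl (Finset.union_subset (subset_thicken B 1) hX)) (twPiece t U B X A)
        else 0) =
      stabilityObs' t U B A := by
  rw [stabilityObs', ← sum_fermionEmbed_twCommPiece t U B A, Finset.mul_sum]
  refine Finset.sum_congr rfl fun X hX => ?_
  have hX' : X ⊆ thicken B 1 := Finset.mem_powerset.1 hX
  rw [dif_pos hX', dif_pos hX', twPiece, fermionEmbed_mul, fermionEmbed_conjTranspose]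
  simp only [fermionEmbed_fermionEmbed, PolySite.incl_trans]
end Pieces
/-! ## §4 Term-wise relocated rows and their soundness -/
section Rows
variable (t U : ℝ)
/-- **Term-wise relocated commutator observable**: `Σ_{X ⊆ B⁺} relocate W (B ∪ X) (g X) [Φ X, X̃w] ∈ 𝔄_W`. -/
def twCommObs (W B : Finset (Site 2)) (Xw : FermionOp B) (g : Finset (Site 2) → Site 2) : FermionOp W :=
  ∑ X ∈ (thicken B 1).powerset, relocate W (B ∪ X) (g X) (twCommPiece t U B X Xw)

/-- **Term-wise relocated stability observable** `Σ_{X ⊆ B⁺} relocate W (B ∪ X) (g X) (Ã⋆[Φ X, Ã]) ∈ 𝔄_W`. -/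
def twStabilityObs (W B : Finset (Site 2)) (A : FermionOp B) (g : Finset (Site 2) → Site 2) : FermionOp W :=
  ∑ X ∈ (thicken B 1).powerset, relocate W (B ∪ X) (g X) (twPiece t U B X A)

/-- **Reader's formula**: only sites `x ∈ B⁺` and bonds `{x, x + e_i} ⊆ B⁺` contribute to `twCommObs`. -/
theorem twCommObs_eq_sum_sites_add_sum_bonds (W B : Finset (Site 2)) (Xw : FermionOp B)
    (g : Finset (Site 2) → Site 2) :
    twCommObs t U W B Xw g =
      ∑ x ∈ thicken B 1, relocate W (B ∪ {x}) (g {x}) (twCommPiece t U B {x} Xw) +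
        ∑ p ∈ (thicken B 1 ×ˢ (univ : Finset (Fin 2))) with p.1 + unitVec p.2 ∈ thicken B 1,
          relocate W (B ∪ {p.1, p.1 + unitVec p.2}) (g {p.1, p.1 + unitVec p.2})
            (twCommPiece t U B {p.1, p.1 + unitVec p.2} Xw) := by
  unfold twCommObs
  exact sum_powerset_eq_of_hubbard_support (thicken B 1)
    (fun X => relocate W (B ∪ X) (g X) (twCommPiece t U B X Xw)) fun X h1 h2 => by
      rw [twCommPiece_eq_zero t U (hubbardFermionInteraction_apply_eq_zero (t := t) (U := U) h1 h2), relocate_zero]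

/-- **Reader's formula**: only sites and bonds of `B⁺` contribute to `twStabilityObs`; the summand for `X` is the translate by
`g X` of `Ã⋆[Φ X, Ã]` on `B ∪ X` (`Φ {x} = U n_{x↑} n_{x↓}`, `Φ {x, x+e_i} = -t Σ_σ (c⋆_{xσ} c_{x+e_i,σ} + h.c.)`). -/
theorem twStabilityObs_eq_sum_sites_add_sum_bonds (W B : Finset (Site 2)) (A : FermionOp B)
    (g : Finset (Site 2) → Site 2) :
    twStabilityObs t U W B A g =
      ∑ x ∈ thicken B 1, relocate W (B ∪ {x}) (g {x}) (twPiece t U B {x} A) +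
        ∑ p ∈ (thicken B 1 ×ˢ (univ : Finset (Fin 2))) with p.1 + unitVec p.2 ∈ thicken B 1,
          relocate W (B ∪ {p.1, p.1 + unitVec p.2}) (g {p.1, p.1 + unitVec p.2})
            (twPiece t U B {p.1, p.1 + unitVec p.2} A) := by
  unfold twStabilityObs
  exact sum_powerset_eq_of_hubbard_support (thicken B 1)
    (fun X => relocate W (B ∪ X) (g X) (twPiece t U B X A)) fun X h1 h2 => by
      rw [twPiece_eq_zero t U (hubbardFermionInteraction_apply_eq_zero (t := t) (U := U) h1 h2), relocate_zero]

/-! **Placement** hypothesis `hg` of the rows: `∀ X ⊆ thicken B 1, ¬ Disjoint X B → Φ X ≠ 0 → shiftSet (g X) (B ∪ X) ⊆ W`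
(only sites of `B` and bonds meeting `B` qualify — a finite check for concrete data, see `GSTermwisePlacement`). -/

/-- `ω_W(twCommObs …) = ω_{B⁺}([H_{B⁺}, X̃w])` for translation-invariant `ω` under the placement. -/
theorem expect_twCommObs {ω : InfVolFermionState 2} (hω : ω.IsTranslationInvariant) {W B : Finset (Site 2)}
    {g : Finset (Site 2) → Site 2}
    (hg : ∀ X ⊆ thicken B 1, ¬ Disjoint X B →
      (hubbardFermionInteraction 2 t U).Φ X ≠ 0 → shiftSet (g X) (B ∪ X) ⊆ W) (Xw : FermionOp B) :
    ω.expect W (twCommObs t U W B Xw g) =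
      ω.expect (thicken B 1)
        ((hubbardFermionInteraction 2 t U).localHamiltonian (thicken B 1) *
            fermionEmbed (PolySite.incl (subset_thicken B 1)) Xw -
          fermionEmbed (PolySite.incl (subset_thicken B 1)) Xw *
            (hubbardFermionInteraction 2 t U).localHamiltonian (thicken B 1)) := by
  rw [twCommObs, map_sum, ← sum_fermionEmbed_twCommPiece, map_sum]
  refine Finset.sum_congr rfl fun X hX => ?_
  have hX' : X ⊆ thicken B 1 := Finset.mem_powerset.1 hX
  rw [dif_pos hX', ω.compatible]
  by_cases hΦ : (hubbardFermionInteraction 2 t U).Φ X = 0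
  · rw [twCommPiece_eq_zero t U hΦ, relocate_zero, map_zero, map_zero]
  by_cases hd : Disjoint X B
  · rw [twCommPiece_eq_zero_of_disjoint t U hd, relocate_zero, map_zero, map_zero]
  · exact expect_relocate hω (hg X hX' hd hΦ) _

/-- `ω_W(twStabilityObs …) = ω_{B⁺}(Ã⋆[H_{B⁺}, Ã])` for translation-invariant `ω` under the placement. -/
theorem expect_twStabilityObs {ω : InfVolFermionState 2} (hω : ω.IsTranslationInvariant) {W B : Finset (Site 2)}
    {g : Finset (Site 2) → Site 2}
    (hg : ∀ X ⊆ thicken B 1, ¬ Disjoint X B →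
      (hubbardFermionInteraction 2 t U).Φ X ≠ 0 → shiftSet (g X) (B ∪ X) ⊆ W) (A : FermionOp B) :
    ω.expect W (twStabilityObs t U W B A g) = ω.expect (thicken B 1) (stabilityObs' t U B A) := by
  rw [twStabilityObs, map_sum, ← sum_fermionEmbed_twPiece, map_sum]
  refine Finset.sum_congr rfl fun X hX => ?_
  have hX' : X ⊆ thicken B 1 := Finset.mem_powerset.1 hX
  rw [dif_pos hX', ω.compatible]
  by_cases hΦ : (hubbardFermionInteraction 2 t U).Φ X = 0
  · rw [twPiece_eq_zero t U hΦ, relocate_zero, map_zero, map_zero]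
  by_cases hd : Disjoint X B
  · rw [twPiece_eq_zero_of_disjoint t U hd, relocate_zero, map_zero, map_zero]
  · exact expect_relocate hω (hg X hX' hd hΦ) _

/-- **E2-type term-wise row (soundness)**: for `A ∈ 𝔄_B` commuting with the local `N`, `S^z` and a placement `g`,
`Re ω_W(twStabilityObs) = Re ω(Ã⋆[H_{B⁺}, Ã]) ≥ 0` (`IsTorusLimitOf.localStability`). [cite: BratteliRobinsonII1997, Prop. 5.3.25] -/
theorem gsObsNode_twStability (n : ℝ) {W B : Finset (Site 2)} {A : FermionOp B}
    (hAN : Commute A totalNumber) (hAS : Commute A HubbardWave0.spinZ)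
    {g : Finset (Site 2) → Site 2}
    (hg : ∀ X ⊆ thicken B 1, ¬ Disjoint X B →
      (hubbardFermionInteraction 2 t U).Φ X ≠ 0 → shiftSet (g X) (B ∪ X) ⊆ W) :
    GSObsNode t U n W (twStabilityObs t U W B A g) 0 := by
  intro ω ψ Ls hLs hω hti _ _ hgs _ _
  rw [expect_twStabilityObs t U hti hg]
  exact (Complex.nonneg_iff.1 (hω.localStability t U hLs hgs hAN hAS)).1
end Rows
/-! ## §5 Stationarity: `ω([H, X̃w]) = 0` for every local word (E1-type rows, two-sided) -/
section Stationarity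
variable {ι : Type*} [Fintype ι]
/-- **An eigenvector sees no commutator**: `⟨φ, [H, X] φ⟩ = 0` for `H` Hermitian, `H φ = E φ`, `E` real. [folklore] -/
theorem expect_commutator_eq_zero_of_mulVec_eq {H : Matrix (Finset ι) (Finset ι) ℂ} (hH : H.IsHermitian)
    {E : ℝ} {φ : Fock ι} (hφ : H *ᵥ φ = ((E : ℝ) : ℂ) • φ) (X : Matrix (Finset ι) (Finset ι) ℂ) :
    expect (H * X - X * H) φ = 0 := by
  have h1 : star φ ᵥ* H = ((E : ℝ) : ℂ) • star φ := by
    rw [← hH.eq, ← star_mulVec, hφ, star_smul]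
    exact congrArg (· • star φ) (Complex.conj_ofReal E)
  rw [Literature.MathematicalPhysics.QuantumLattice.expect, sub_mulVec, ← mulVec_mulVec, ← mulVec_mulVec, hφ, mulVec_smul, dotProduct_sub, dotProduct_smul,
    dotProduct_mulVec, h1, smul_dotProduct, sub_self]

variable {d : ℕ}
/-- **Finite volume**: in a sector ground state `φ`, `⟨φ, Γ([H_{Λ⁺}, X̃]) φ⟩ = 0` for every local `X ∈ 𝔄_Λ`
(`hubbardTorus_commutator_fermionEmbed` + the eigenvector equation). [cite: BratteliRobinsonII1997, Thm. 6.2.4] -/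
theorem expect_fermionEmbed_commutator_eq_zero (L : ℕ) [NeZero L] (t U : ℝ) {Λ : Finset (Site d)}
    (hInj : Set.InjOn (Torus.proj (d := d) L) ↑(thicken (thicken Λ 1) 1)) {N : ℕ} {M : ℝ}
    {φ : Fock (Orb (FermionTorus d L))} (hφ : IsGroundStateInSector (hubbardTorus d L t U) N M φ)
    (X : FermionOp Λ) :
    expect (fermionEmbed (PolySite.toTorusEmb L (hInj.mono (by exact_mod_cast subset_thicken (thicken Λ 1) 1)))
        ((hubbardFermionInteraction d t U).localHamiltonian (thicken Λ 1) *
            fermionEmbed (PolySite.incl (subset_thicken Λ 1)) X -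
          fermionEmbed (PolySite.incl (subset_thicken Λ 1)) X *
            (hubbardFermionInteraction d t U).localHamiltonian (thicken Λ 1))) φ = 0 := by
  have hclosed : ∀ x ∈ Λ, ∀ i : Fin d, x + unitVec i ∈ thicken Λ 1 ∧ x - unitVec i ∈ thicken Λ 1 :=
    fun x hx i => ⟨add_unitVec_mem_thicken_one hx i, sub_unitVec_mem_thicken_one hx i⟩
  rw [← hubbardTorus_commutator_fermionEmbed L t U (subset_thicken Λ 1) hclosed hInj X]
  exact expect_commutator_eq_zero_of_mulVec_eq
    (hubbardTorus_isHermitian (hamiltonian_isHermitian_and_commute_holds _) t U) hφ.2.2 _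

/-- **Finite volume, translation average**: the averaged torus expectation of `[H_{Λ⁺}, X̃]` vanishes too. [folklore] -/
theorem torusAvgExpectAt_commutator_eq_zero (L : ℕ) [NeZero L] (t U : ℝ) {Λ : Finset (Site d)}
    (hInj : Set.InjOn (Torus.proj (d := d) L) ↑(thicken (thicken Λ 1) 1)) {N : ℕ} {M : ℝ}
    {ψ : Fock (Orb (FermionTorus d L))} (hψ : IsGroundStateInSector (hubbardTorus d L t U) N M ψ)
    (X : FermionOp Λ) :
    torusAvgExpectAt L (thicken Λ 1)
        ((hubbardFermionInteraction d t U).localHamiltonian (thicken Λ 1) *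
            fermionEmbed (PolySite.incl (subset_thicken Λ 1)) X -
          fermionEmbed (PolySite.incl (subset_thicken Λ 1)) X *
            (hubbardFermionInteraction d t U).localHamiltonian (thicken Λ 1)) ψ = 0 := by
  have h₁ : Set.InjOn (Torus.proj (d := d) L) ↑(thicken Λ 1) :=
    hInj.mono (by exact_mod_cast subset_thicken (thicken Λ 1) 1)
  rw [torusAvgExpectAt_of_injOn L h₁, Finset.sum_eq_zero fun v _ => ?_, mul_zero]
  exact expect_fermionEmbed_commutator_eq_zero L t U hInj
    (hψ.fockTranslate_mulVec v (relabel_translate_hubbardTorus v t U)) X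

/-- **Stationarity of torus-limit ground states**: `ω([H_{Λ⁺}, X̃]) = 0` for every region `Λ` and EVERY `X ∈ 𝔄_Λ` when `ω`
is a torus limit of averaged sector ground states (`ω ∘ δ = 0`, BR II §5.3.3/§6.2.2). [cite: BratteliRobinsonII1997, Prop. 5.3.25] -/
theorem stationarity_of_isTorusLimitOf (t U : ℝ) {ω : InfVolFermionState d}
    {ψ : ∀ L, Fock (Orb (FermionTorus d L))} {Ls : ℕ → ℕ} (h : ω.IsTorusLimitOf ψ Ls)
    (hLs : Tendsto Ls atTop atTop) {N : ℕ → ℕ} {M : ℕ → ℝ}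
    (hgs : ∀ j, IsGroundStateInSector (hubbardTorus d (Ls j) t U) (N j) (M j) (ψ (Ls j)))
    {Λ : Finset (Site d)} (X : FermionOp Λ) :
    ω.expect (thicken Λ 1)
        ((hubbardFermionInteraction d t U).localHamiltonian (thicken Λ 1) *
            fermionEmbed (PolySite.incl (subset_thicken Λ 1)) X -
          fermionEmbed (PolySite.incl (subset_thicken Λ 1)) X *
            (hubbardFermionInteraction d t U).localHamiltonian (thicken Λ 1)) = 0 := by
  refine tendsto_nhds_unique (h (thicken Λ 1) _) (tendsto_const_nhds.congr' ?_)
  filter_upwards [eventually_injOn_proj_of_tendsto (thicken (thicken Λ 1) 1) hLs, hLs.eventually_ge_atTop 1]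
    with j hInj hj
  haveI : NeZero (Ls j) := ⟨by omega⟩
  rw [torusAvgExpect_eq]
  exact (torusAvgExpectAt_commutator_eq_zero (Ls j) t U hInj (hgs j) X).symm

/-- **E1-type term-wise rows (soundness, two-sided)**: for EVERY word `Xw ∈ 𝔄_B` and a placement, `Re ω_W(±twCommObs) ≥ 0`. -/
theorem gsObsNode_twStationarity (t U n : ℝ) {W B : Finset (Site 2)} (Xw : FermionOp B)
    {g : Finset (Site 2) → Site 2}
    (hg : ∀ X ⊆ thicken B 1, ¬ Disjoint X B →
      (hubbardFermionInteraction 2 t U).Φ X ≠ 0 → shiftSet (g X) (B ∪ X) ⊆ W) :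
    GSObsNode t U n W (twCommObs t U W B Xw g) 0 ∧ GSObsNode t U n W (-twCommObs t U W B Xw g) 0 := by
  constructor
  · intro ω ψ Ls hLs hω hti _ _ hgs _ _
    rw [expect_twCommObs t U hti hg, stationarity_of_isTorusLimitOf t U hω hLs hgs Xw, Complex.zero_re]
  · intro ω ψ Ls hLs hω hti _ _ hgs _ _
    rw [map_neg, expect_twCommObs t U hti hg, stationarity_of_isTorusLimitOf t U hω hLs hgs Xw, neg_zero,
      Complex.zero_re]

/-- The E1 identity itself: `ω_W(twCommObs t U W B Xw g) = 0` along the class (an equality row). -/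
theorem expect_twCommObs_eq_zero (t U : ℝ) {W B : Finset (Site 2)} (Xw : FermionOp B)
    {g : Finset (Site 2) → Site 2}
    (hg : ∀ X ⊆ thicken B 1, ¬ Disjoint X B →
      (hubbardFermionInteraction 2 t U).Φ X ≠ 0 → shiftSet (g X) (B ∪ X) ⊆ W) {ω : InfVolFermionState 2}
    {ψ : ∀ L, Fock (Orb (FermionTorus 2 L))} {Ls : ℕ → ℕ} (hω : ω.IsTorusLimitOf ψ Ls)
    (hLs : Tendsto Ls atTop atTop) {N : ℕ → ℕ} {M : ℕ → ℝ}
    (hgs : ∀ j, IsGroundStateInSector (hubbardTorus 2 (Ls j) t U) (N j) (M j) (ψ (Ls j))) :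
    ω.expect W (twCommObs t U W B Xw g) = 0 := by
  rw [expect_twCommObs t U hω.isTranslationInvariant hg, stationarity_of_isTorusLimitOf t U hω hLs hgs Xw]

/-- **Any complex multiple of an E1 row is a floor-`0` node** (stationarity multipliers are sign-free). -/
theorem gsObsNode_smul_twCommObs (t U n : ℝ) {W B : Finset (Site 2)} (Xw : FermionOp B)
    {g : Finset (Site 2) → Site 2}
    (hg : ∀ X ⊆ thicken B 1, ¬ Disjoint X B →
      (hubbardFermionInteraction 2 t U).Φ X ≠ 0 → shiftSet (g X) (B ∪ X) ⊆ W) (z : ℂ) :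
    GSObsNode t U n W (z • twCommObs t U W B Xw g) 0 := by
  intro ω ψ Ls hLs hω hti _ _ hgs _ _
  rw [map_smul, expect_twCommObs t U hti hg, stationarity_of_isTorusLimitOf t U hω hLs hgs Xw, smul_zero,
    Complex.zero_re]

/-- **The term-wise rows of a certificate are ONE node**: `Σ_i y_i · twStabilityObs_i + Σ_k z_k · twCommObs_k`
(`y_i ≥ 0`, `z_k : ℂ`) is a `GSObsNode t U n W · 0` — the window leg `O` of `energyDensity2D_ge_of_split`. -/
theorem gsObsNode_twRows (t U n : ℝ) {W : Finset (Site 2)} {ι κ : Type*} (s : Finset ι) (sk : Finset κ)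
    {B : ι → Finset (Site 2)} (A : ∀ i, FermionOp (B i)) (g : ι → Finset (Site 2) → Site 2) (y : ι → ℝ)
    (hy : ∀ i ∈ s, 0 ≤ y i) (hAN : ∀ i ∈ s, Commute (A i) totalNumber)
    (hAS : ∀ i ∈ s, Commute (A i) HubbardWave0.spinZ)
    (hg : ∀ i ∈ s, ∀ X ⊆ thicken (B i) 1,
      ¬ Disjoint X (B i) →
      (hubbardFermionInteraction 2 t U).Φ X ≠ 0 → shiftSet (g i X) (B i ∪ X) ⊆ W)
    {B' : κ → Finset (Site 2)} (Xw : ∀ k, FermionOp (B' k)) (g' : κ → Finset (Site 2) → Site 2) (z : κ → ℂ)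
    (hg' : ∀ k ∈ sk, ∀ X ⊆ thicken (B' k) 1,
      ¬ Disjoint X (B' k) →
      (hubbardFermionInteraction 2 t U).Φ X ≠ 0 → shiftSet (g' k X) (B' k ∪ X) ⊆ W) :
    GSObsNode t U n W
      ((∑ i ∈ s, ((y i : ℝ) : ℂ) • twStabilityObs t U W (B i) (A i) (g i)) +
        ∑ k ∈ sk, z k • twCommObs t U W (B' k) (Xw k) (g' k)) 0 := by
  have h₁ := gsObsNode_sum_nonneg s fun i hi =>
    gsObsNode_smul_nonneg (gsObsNode_twStability t U n (hAN i hi) (hAS i hi) (hg i hi)) (hy i hi)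
  have h₂ := gsObsNode_sum_nonneg sk fun k hk => gsObsNode_smul_twCommObs t U n (Xw k) (hg' k hk) (z k)
  simpa only [add_zero] using h₁.add h₂
end Stationarity

end Summit.Ventures.CertifiedManyBodySolver.HubbardAlg.GSTermwiseRows

end
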